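/-
Copyright (c) 2026 the pub-hodgecm-mathlib formalisation cell (harness21).  Prover seat hodgecm-mathlib-K2E3-p23 (g6), HCML Track B «K2-LIT» ∕ h413
(`stmt-HodgeConjecture-24833`), line `K2_E3_EllipticInputs`, leaf (nsc-S-A′) `sig_K2E3GL3PrincipalBlockStandardSpan`, road «EXP» — REGULARITY TOOLS (REG) shared by the case bricks C0-IRR ∕ C1 ∕ C1′ ∕ C1″ ∕ C2 of the architect's `MEMO-SA-architecture.v2.K2E3-p25-g2.md` §3; written for C1 (architect K2E3-p25 (g2) «=» on CENSUS-C1 v0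
11:39:48Z: «local tch-injectivity lemma fine, fold into REG later»; dealer K2E3-plan (g4) D96).  2026-09-04.
-/
import Summits.HodgeConjecture.HodgeConjecture.Theorems.K2E3GL3PrincipalSeriesExponents      -- ★ H0-a (K2E3-p25 g0): `mult (I θ) η = #{w : η = tch θ^w}`
import Summits.HodgeConjecture.HodgeConjecture.Theorems.K2E3GL3StandardModuleEmbedding       -- ★ STD-EMB (K2E3-p03 g6): `isOpen_ker_tch`, `coe_nuHalf_apply`, `normAbs_cpow_half_mul_self`, the parametrisation `![ην½⁻¹, ην½, ψ]`
import HarnessLib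

/-!
# Crux `H413` — leaf (nsc-S-A′), road «EXP», REG: a REGULAR triple `θ` has six weights of multiplicity one in `I θ`, every weight of `I θ` is one of them; `![ην½⁻¹, ην½, ψ]` is regular

Cell `hodgecm-mathlib`, Track B; THEOREMS ONLY; count-neutral helper (`--supports stmt-HodgeConjecture-24833 --as helper`).  Currency (CONVENTIONS 08:40Z, MEMO v2 §0, H0 HEADS
FREEZE 11:28:14Z): `LB 3 = Π a : Fin 3, GL {i // id i = a} F`, `tch θ = ∏ a, (θ a) ∘ det ∘ ev_a`, `I θ = parabolicIndGL F id (𝟙.twist (tch θ))`,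
`mult V η = finrank ℂ ↥(⨅ m, maxGenEigenspace (normalizedJacquetGL F id V m) (η m))` (inline), `I₂ x y` = ★ G1 spelling, `ν½ = (unramifiedTwist F (1∕2)).toMonoidHom`.
* §1 REGULARITY (any `θ` with open kernels): `tch_apply_mulSingle_scalar`, `eq_of_tch_coe_eq` (`tch` is injective on triples), **`finrank_weightSpace_principalSeries_perm_eq_one`**
  (`θ` injective ⇒ `mult (I θ) (tch θ^σ) = 1`), **`exists_perm_of_finrank_weightSpace_principalSeries_ne_zero`** (a weight of `I θ` is a `tch θ^σ`), `perm_fin_three_cases`.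
* §2 `ν½`-bookkeeping for C1 (`ν½ = (unramifiedTwist F (1∕2)).toMonoidHom`, ★ STD-EMB's parametrisation `θ = ![ην½⁻¹, ην½, ψ]`): `mul_nuHalf_inv_ne_mul_nuHalf`
  (`ην½⁻¹ ≠ ην½`), `injective_theta` (`ψ ≠ ην½^{±1} ⇒ θ` injective, i.e. REGULAR).
[BernsteinZelevinsky1977, §2.3, Cor. 2.13, Thm. 2.9]; [Zelevinsky1980, §4.2, Thm. 6.1]; [Casselman1995, §6.3].
HONEST LABEL: HC_CM is proved only modulo the 7 printed citations (2 remaining named inputs: hLiu418 = stmt-HodgeConjecture-24832, h413 = stmt-HodgeConjecture-24833) until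
rung 0 closes; count-neutral helper, closes no socket; UNCONDITIONAL.

## References
* [BernsteinZelevinsky1977] I. N. Bernstein, A. V. Zelevinsky, *Induced representations of reductive p-adic groups I*, Ann. Sci. ÉNS 10 (1977), §2.3, Cor. 2.13, Thm. 2.9.
* [Zelevinsky1980] A. V. Zelevinsky, *Induced representations of reductive p-adic groups II*, Ann. Sci. ÉNS 13 (1980), §4.2, Thm. 6.1.
* [Casselman1995] W. Casselman, *Introduction to the theory of admissible representations of p-adic reductive groups* (draft 1995), §6.3.
-/

set_option autoImplicit false
-- the mandated namespace repeats `HodgeConjecture.HodgeConjecture`, as in every `Theorems/*.lean` of this sub-problem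
set_option linter.dupNamespace false

noncomputable section

open Representation Module Function Literature.NumberTheory.Automorphic Literature.NumberTheory.GaloisRepresentations.IsNonarchimedeanLocalField
open Literature.NumberTheory.GaloisRepresentations
open scoped MatrixGroups NNReal
open Summit.HodgeConjecture.HodgeConjecture.Cruxes.H413.K2E3GL3PrincipalSeriesExponents (finrank_weightSpace_principalSeries_three_tch)
open Summit.HodgeConjecture.HodgeConjecture.Cruxes.H413.K2E3GL3StandardModuleEmbedding (isOpen_ker_tch normAbs_cpow_half_mul_self coe_nuHalf_apply)

namespace Summit.HodgeConjecture.HodgeConjecture.Cruxes.H413.K2E3GL3PrincipalSeriesRegular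

/-! ## §1 Regularity: `tch` is injective on triples; a regular `θ` has six weights of multiplicity one -/

section Regular

variable {F : Type} [Field F] [ValuativeRel F] [TopologicalSpace F] [IsNonarchimedeanLocalField F]

omit [ValuativeRel F] [TopologicalSpace F] [IsNonarchimedeanLocalField F] in
/-- `{i : Fin 3 // id i = a}` has exactly one element. [folklore] -/
theorem card_block_eq_one (a : Fin 3) : Fintype.card {i : Fin 3 // (id : Fin 3 → Fin 3) i = a} = 1 :=
  Fintype.card_eq_one_iff.2 ⟨⟨a, rfl⟩, fun y => Subtype.ext y.2⟩

omit [ValuativeRel F] [TopologicalSpace F] [IsNonarchimedeanLocalField F] in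
/-- **`tch θ` at a one-block scalar**: `tch θ (ι_a(u)) = θ_a(u)`. [cite: BernsteinZelevinsky1977, §2.3] -/
theorem tch_apply_mulSingle_scalar (θ : Fin 3 → (Fˣ →* ℂˣ)) (a : Fin 3) (u : Fˣ) :
    (∏ a : Fin 3, ((θ) a).comp (Matrix.GeneralLinearGroup.det.comp (Pi.evalMonoidHom (fun a : Fin 3 => GL {i : Fin 3 // (id : Fin 3 → Fin 3) i = a} F) a))) (Pi.mulSingle a (Matrix.GeneralLinearGroup.scalar {i : Fin 3 // (id : Fin 3 → Fin 3) i = a} u)) = θ a u := by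
  rw [MonoidHom.finsetProd_apply, Finset.prod_eq_single a]
  · rw [MonoidHom.comp_apply, MonoidHom.comp_apply, Pi.evalMonoidHom_apply, Pi.mulSingle_eq_same, Matrix.GeneralLinearGroup.det_scalar,
      card_block_eq_one, pow_one]
  · intro b _ hb
    rw [MonoidHom.comp_apply, MonoidHom.comp_apply, Pi.evalMonoidHom_apply, Pi.mulSingle_eq_of_ne hb, map_one, map_one]
  · intro h
    exact absurd (Finset.mem_univ a) h

omit [ValuativeRel F] [TopologicalSpace F] [IsNonarchimedeanLocalField F] in
/-- **`tch` IS INJECTIVE ON TRIPLES** (as `ℂ`-valued functions on the torus): `⇑(tch θ₁) = ⇑(tch θ₂) ⇒ θ₁ = θ₂` (evaluate at one-block scalars). [cite: BernsteinZelevinsky1977, §2.3] -/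
theorem eq_of_tch_coe_eq (θ₁ θ₂ : Fin 3 → (Fˣ →* ℂˣ))
    (h : (fun m : (Π a : Fin 3, GL {i : Fin 3 // (id : Fin 3 → Fin 3) i = a} F) => (((∏ a : Fin 3, ((θ₁) a).comp (Matrix.GeneralLinearGroup.det.comp (Pi.evalMonoidHom (fun a : Fin 3 => GL {i : Fin 3 // (id : Fin 3 → Fin 3) i = a} F) a))) m : ℂˣ) : ℂ)) =
      (fun m : (Π a : Fin 3, GL {i : Fin 3 // (id : Fin 3 → Fin 3) i = a} F) => (((∏ a : Fin 3, ((θ₂) a).comp (Matrix.GeneralLinearGroup.det.comp (Pi.evalMonoidHom (fun a : Fin 3 => GL {i : Fin 3 // (id : Fin 3 → Fin 3) i = a} F) a))) m : ℂˣ) : ℂ))) : θ₁ = θ₂ := by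
  funext a
  ext u
  have key := congrFun h (Pi.mulSingle a (Matrix.GeneralLinearGroup.scalar {i : Fin 3 // (id : Fin 3 → Fin 3) i = a} u))
  simp only [tch_apply_mulSingle_scalar] at key
  exact key

open scoped Classical in
/-- **A REGULAR `θ` HAS SIX WEIGHTS OF MULTIPLICITY ONE**: for `θ` injective (pairwise distinct letters) with open kernels and any `σ ∈ S₃`, `mult (I θ) (tch θ^σ) = 1`
(`θ^σ a = θ (σ⁻¹ a)`; ★ H0-a counts `#{w : tch θ^σ = tch θ^w}`, which is `{σ}` by `eq_of_tch_coe_eq`). [cite: BernsteinZelevinsky1977, Thm. 5.2] [cite: Casselman1995, Thm. 6.3.5] -/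
theorem finrank_weightSpace_principalSeries_perm_eq_one (θ : Fin 3 → (Fˣ →* ℂˣ)) (hθ : ∀ a, IsOpen (((θ a).ker : Subgroup Fˣ) : Set Fˣ))
    (hinj : Function.Injective θ) (σ : Equiv.Perm (Fin 3)) (θ' : Fin 3 → (Fˣ →* ℂˣ)) (hθ' : ∀ a, θ' a = θ (σ.symm a)) :
    finrank ℂ ↥(⨅ m, Module.End.maxGenEigenspace (normalizedJacquetGL F (id : Fin 3 → Fin 3) (parabolicIndGL F (id : Fin 3 → Fin 3) ((Representation.trivial ℂ (Π a : Fin 3, GL {i : Fin 3 // (id : Fin 3 → Fin 3) i = a} F) ℂ).twist (∏ a : Fin 3, ((θ) a).comp (Matrix.GeneralLinearGroup.det.comp (Pi.evalMonoidHom (fun a : Fin 3 => GL {i : Fin 3 // (id : Fin 3 → Fin 3) i = a} F) a))))) m) (((∏ a : Fin 3, ((θ') a).comp (Matrix.GeneralLinearGroup.det.comp (Pi.evalMonoidHom (fun a : Fin 3 => GL {i : Fin 3 // (id : Fin 3 → Fin 3) i = a} F) a))) m : ℂˣ) : ℂ)) = 1 := by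
  obtain ⟨-, h⟩ := finrank_weightSpace_principalSeries_three_tch θ (isOpen_ker_tch θ hθ) (fun m : (Π a : Fin 3, GL {i : Fin 3 // (id : Fin 3 → Fin 3) i = a} F) => (((∏ a : Fin 3, ((θ') a).comp (Matrix.GeneralLinearGroup.det.comp (Pi.evalMonoidHom (fun a : Fin 3 => GL {i : Fin 3 // (id : Fin 3 → Fin 3) i = a} F) a))) m : ℂˣ) : ℂ))
  refine (show finrank ℂ ↥(⨅ m, Module.End.maxGenEigenspace (normalizedJacquetGL F (id : Fin 3 → Fin 3) (parabolicIndGL F (id : Fin 3 → Fin 3) ((Representation.trivial ℂ (Π a : Fin 3, GL {i : Fin 3 // (id : Fin 3 → Fin 3) i = a} F) ℂ).twist (∏ a : Fin 3, ((θ) a).comp (Matrix.GeneralLinearGroup.det.comp (Pi.evalMonoidHom (fun a : Fin 3 => GL {i : Fin 3 // (id : Fin 3 → Fin 3) i = a} F) a))))) m) (((∏ a : Fin 3, ((θ') a).comp (Matrix.GeneralLinearGroup.det.comp (Pi.evalMonoidHom (fun a : Fin 3 => GL {i : Fin 3 // (id : Fin 3 → Fin 3) i = a} F) a))) m : ℂˣ)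 : ℂ)) = _ from h).trans ?_
  rw [Finset.card_eq_one]
  refine ⟨σ, Finset.ext fun w => ?_⟩
  simp only [Finset.mem_filter, Finset.mem_univ, true_and, Finset.mem_singleton]
  constructor
  · intro hw
    have key := eq_of_tch_coe_eq θ' (fun a => θ (w.symm a)) hw
    have hsw : ∀ a, σ.symm a = w.symm a := fun a => hinj ((hθ' a).symm.trans (congrFun key a))
    have hs : σ.symm = w.symm := Equiv.ext hsw
    have := congrArg Equiv.symm hs
    simpa using this.symm
  · intro hw
    rw [hw]
    have hθ'' : θ' = fun a => θ (σ.symm a) := funext hθ'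
    subst hθ''
    rfl

open scoped Classical in
/-- **EVERY WEIGHT OF `I θ` IS A `tch θ^σ`**: `mult (I θ) χ ≠ 0 ⇒ ∃ σ, χ = ⇑(tch θ^σ)` (★ H0-a). [cite: BernsteinZelevinsky1977, Thm. 5.2] [cite: Casselman1995, Thm. 6.3.5] -/
theorem exists_perm_of_finrank_weightSpace_principalSeries_ne_zero (θ : Fin 3 → (Fˣ →* ℂˣ)) (hθ : ∀ a, IsOpen (((θ a).ker : Subgroup Fˣ) : Set Fˣ))
    (χ : (Π a : Fin 3, GL {i : Fin 3 // (id : Fin 3 → Fin 3) i = a} F) → ℂ)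
    (h : finrank ℂ ↥(⨅ m, Module.End.maxGenEigenspace (normalizedJacquetGL F (id : Fin 3 → Fin 3) (parabolicIndGL F (id : Fin 3 → Fin 3) ((Representation.trivial ℂ (Π a : Fin 3, GL {i : Fin 3 // (id : Fin 3 → Fin 3) i = a} F) ℂ).twist (∏ a : Fin 3, ((θ) a).comp (Matrix.GeneralLinearGroup.det.comp (Pi.evalMonoidHom (fun a : Fin 3 => GL {i : Fin 3 // (id : Fin 3 → Fin 3) i = a} F) a))))) m) (χ m)) ≠ 0) :
    ∃ σ : Equiv.Perm (Fin 3), χ = (fun m : (Π a : Fin 3, GL {i : Fin 3 // (id : Fin 3 → Fin 3) i = a} F) => (((∏ a : Fin 3, ((fun a => θ (σ.symm a)) a).comp (Matrix.GeneralLinearGroup.det.comp (Pi.evalMonoidHom (fun a : Fin 3 => GL {i : Fin 3 // (id : Fin 3 → Fin 3) i = a} F) a))) m : ℂˣ) : ℂ)) := by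
  obtain ⟨-, hc⟩ := finrank_weightSpace_principalSeries_three_tch θ (isOpen_ker_tch θ hθ) χ
  have hc' : finrank ℂ ↥(⨅ m, Module.End.maxGenEigenspace (normalizedJacquetGL F (id : Fin 3 → Fin 3) (parabolicIndGL F (id : Fin 3 → Fin 3) ((Representation.trivial ℂ (Π a : Fin 3, GL {i : Fin 3 // (id : Fin 3 → Fin 3) i = a} F) ℂ).twist (∏ a : Fin 3, ((θ) a).comp (Matrix.GeneralLinearGroup.det.comp (Pi.evalMonoidHom (fun a : Fin 3 => GL {i : Fin 3 // (id : Fin 3 → Fin 3) i = a} F) a))))) m) (χ m)) = _ := hc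
  rw [hc'] at h
  obtain ⟨w, hw⟩ := Finset.card_ne_zero.1 h
  exact ⟨w, (Finset.mem_filter.1 hw).2⟩

omit [ValuativeRel F] [TopologicalSpace F] [IsNonarchimedeanLocalField F] in
/-- The six elements of `S₃`, by their values. [folklore] -/
theorem perm_fin_three_cases (σ : Equiv.Perm (Fin 3)) :
    (![σ.symm 0, σ.symm 1, σ.symm 2] : Fin 3 → Fin 3) = ![0, 1, 2] ∨ (![σ.symm 0, σ.symm 1, σ.symm 2] : Fin 3 → Fin 3) = ![0, 2, 1] ∨
      (![σ.symm 0, σ.symm 1, σ.symm 2] : Fin 3 → Fin 3) = ![1, 0, 2] ∨ (![σ.symm 0, σ.symm 1, σ.symm 2] : Fin 3 → Fin 3) = ![1, 2, 0] ∨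
      (![σ.symm 0, σ.symm 1, σ.symm 2] : Fin 3 → Fin 3) = ![2, 0, 1] ∨ (![σ.symm 0, σ.symm 1, σ.symm 2] : Fin 3 → Fin 3) = ![2, 1, 0] := by
  revert σ
  decide

omit [ValuativeRel F] [TopologicalSpace F] [IsNonarchimedeanLocalField F] in
/-- **The six reorderings of a triple**: `θ^σ` is one of the six explicit vectors. [folklore] -/
theorem perm_theta_cases (θ : Fin 3 → (Fˣ →* ℂˣ)) (σ : Equiv.Perm (Fin 3)) :
    (fun a => θ (σ.symm a)) = ![θ 0, θ 1, θ 2] ∨ (fun a => θ (σ.symm a)) = ![θ 0, θ 2, θ 1] ∨ (fun a => θ (σ.symm a)) = ![θ 1, θ 0, θ 2] ∨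
      (fun a => θ (σ.symm a)) = ![θ 1, θ 2, θ 0] ∨ (fun a => θ (σ.symm a)) = ![θ 2, θ 0, θ 1] ∨ (fun a => θ (σ.symm a)) = ![θ 2, θ 1, θ 0] := by
  have hfun : (fun a => θ (σ.symm a)) = fun a => θ ((![σ.symm 0, σ.symm 1, σ.symm 2] : Fin 3 → Fin 3) a) := by
    funext a; fin_cases a <;> rfl
  rw [hfun]
  rcases perm_fin_three_cases σ with h | h | h | h | h | h <;> rw [h]
  · exact Or.inl (funext fun a => by fin_cases a <;> rfl)
  · exact Or.inr (Or.inl (funext fun a => by fin_cases a <;> rfl))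
  · exact Or.inr (Or.inr (Or.inl (funext fun a => by fin_cases a <;> rfl)))
  · exact Or.inr (Or.inr (Or.inr (Or.inl (funext fun a => by fin_cases a <;> rfl))))
  · exact Or.inr (Or.inr (Or.inr (Or.inr (Or.inl (funext fun a => by fin_cases a <;> rfl)))))
  · exact Or.inr (Or.inr (Or.inr (Or.inr (Or.inr (funext fun a => by fin_cases a <;> rfl)))))

end Regular

/-! ## §2 `ν½`-bookkeeping: the triple `θ = ![ην½⁻¹, ην½, ψ]` is regular -/

section NuHalf

variable {F : Type} [Field F] [ValuativeRel F] [TopologicalSpace F] [IsNonarchimedeanLocalField F] (η ψ : Fˣ →* ℂˣ)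

/-- **`ην½⁻¹ ≠ ην½`** (`ν½² = ν` and `ν(ϖ) = ‖ϖ‖ < 1`). [cite: Zelevinsky1980, §4.2] -/
theorem mul_nuHalf_inv_ne_mul_nuHalf : η * ((unramifiedTwist F (1 / 2) : QuasiChar F).toMonoidHom)⁻¹ ≠ η * ((unramifiedTwist F (1 / 2) : QuasiChar F).toMonoidHom) := by
  intro h
  have h1 : ((unramifiedTwist F (1 / 2) : QuasiChar F).toMonoidHom)⁻¹ = ((unramifiedTwist F (1 / 2) : QuasiChar F).toMonoidHom) := mul_left_cancel h
  obtain ⟨ϖ, hϖ0, hϖ1⟩ := exists_valuation_pos_lt_one (F := F)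
  have hϖ : (ϖ : F) ≠ 0 := (Valuation.ne_zero_iff _).1 hϖ0
  have hu := congrArg (fun χ : Fˣ →* ℂˣ => ((χ (Units.mk0 ϖ hϖ) : ℂˣ) : ℂ) * ((((unramifiedTwist F (1 / 2) : QuasiChar F).toMonoidHom) (Units.mk0 ϖ hϖ) : ℂˣ) : ℂ)) h1
  simp only [MonoidHom.inv_apply, Units.val_inv_eq_inv_val] at hu
  rw [inv_mul_cancel₀ (Units.ne_zero _), coe_nuHalf_apply, Units.val_mk0, normAbs_cpow_half_mul_self] at hu
  have hlt : ((normAbs F ϖ : ℝ≥0) : ℝ) < 1 := by exact_mod_cast (normAbs_lt_one_iff.2 hϖ1)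
  have h1' : (((normAbs F ϖ : ℝ≥0) : ℝ) : ℂ) = 1 := hu.symm
  have : ((normAbs F ϖ : ℝ≥0) : ℝ) = 1 := by exact_mod_cast h1'
  exact absurd this hlt.ne

/-- **`θ = ![ην½⁻¹, ην½, ψ]` is injective** for `ψ ≠ ην½⁻¹`, `ψ ≠ ην½`. [cite: Zelevinsky1980, §4.2] -/
theorem injective_theta (hψ₀ : ψ ≠ η * ((unramifiedTwist F (1 / 2) : QuasiChar F).toMonoidHom)⁻¹) (hψ₁ : ψ ≠ η * ((unramifiedTwist F (1 / 2) : QuasiChar F).toMonoidHom)) :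
    Function.Injective (![η * ((unramifiedTwist F (1 / 2) : QuasiChar F).toMonoidHom)⁻¹, η * ((unramifiedTwist F (1 / 2) : QuasiChar F).toMonoidHom), ψ] : Fin 3 → (Fˣ →* ℂˣ)) := by
  have h01 := mul_nuHalf_inv_ne_mul_nuHalf η
  intro i j hij
  fin_cases i <;> fin_cases j
  all_goals first
    | rfl
    | (exfalso
       simp only [Matrix.cons_val_zero, Matrix.cons_val_one, Matrix.cons_val_two, Matrix.head_cons, Matrix.tail_cons, Fin.zero_eta, Fin.mk_one,
         Fin.reduceFinMk] at hij
       first | exact h01 hij | exact h01 hij.symm | exact hψ₀ hij | exact hψ₀ hij.symm | exact hψ₁ hij | exact hψ₁ hij.symm)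

end NuHalf

end Summit.HodgeConjecture.HodgeConjecture.Cruxes.H413.K2E3GL3PrincipalSeriesRegular

end
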